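import Summits.CriticalPhenomena.PercolationContinuityZ3.Theses.PercDivergentSlabLadder
import Summits.CriticalPhenomena.PercolationContinuityZ3.Theorems.PercNearOneGluingNoHeavyLowerTailCSHTheoremOne
import Literature.Probability.Percolation.SubgraphMonotonicity
import Literature.Probability.Percolation.ConnectivityProofs
import HarnessLib

/-!
# `PercDivergentSlabLadder.SublinearRungOfOneScale` (stmt-CriticalPhenomena-6704) — SETTLED after continuity

Item `stmt-CriticalPhenomena-6704` of route `CriticalPhenomena/PercDivergentSlabLadder` (support (glue)):
`OneScaleSlabs → Rung(f)` for every nondecreasing sublinear `f`.  With `θ(p_c(ℤ³)) = 0` (p205010), `θ` of every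
INDUCED subgraph of `ℤ³` vanishes at `p_c` at every vertex: `θ_{G[S]}(x, p_c) ≤ θ_{ℤ³}(x, p_c)`
(`theta_induce_le_holds`) `= θ_{ℤ³}(0, p_c)` (`theta_zdGraph_eq_theta_zero`) `= 0`; the one-scale hypothesis
and the growth conditions on `f` are not used (same closing as the sibling rungs stmt-6705/6706, lead gen 28).

builds on p205010 (kernel theorem, internal audit signed; external expert review pending) — USED
(`CSH.percolationContinuityZ3_holds`).  RSW3 lane, prover P2 gen 31.
-/

noncomputable section

namespace Summit.CriticalPhenomena.PercolationContinuityZ3.Theorems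

namespace PercDivergentSlabLadderSublinearRungOfOneScale

open MeasureTheory Literature.Probability.Percolation Literature.Probability.LatticeModels

/-- **`PercDivergentSlabLadder.SublinearRungOfOneScale` (stmt-CriticalPhenomena-6704), settled**: for every `f`
and every vertex `x` of `V_f = {|z_0| ≤ f(max(|z_1|,|z_2|))}`, `θ_{G[V_f]}(x, p_c) ≤ θ_{ℤ³}(p_c) = 0`. -/
theorem sublinearRungOfOneScale_proof :
    Summit.CriticalPhenomena.PercolationContinuityZ3.Theses.PercDivergentSlabLadder.SublinearRungOfOneScale := by
  unfold Summit.CriticalPhenomena.PercolationContinuityZ3.Theses.PercDivergentSlabLadder.SublinearRungOfOneScale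
  intro _ f _ _ x
  have h0 : theta (zdGraph 3) (0 : Site 3) (criticalProbI 3) = 0 := CSH.percolationContinuityZ3_holds
  have h1 := theta_induce_le_holds (zdGraph 3) _ (x : Site 3) x.2 (criticalProbI 3)
  rw [theta_zdGraph_eq_theta_zero, h0] at h1
  exact le_antisymm h1 (by unfold theta; exact measureReal_nonneg)

end PercDivergentSlabLadderSublinearRungOfOneScale

end Summit.CriticalPhenomena.PercolationContinuityZ3.Theorems

end
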